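import Summits.AnomalousDissipation.AnomalousDissipation.Theorems.SolenoidalFractalHomogenisationRealisedQuasiStaticCellLawSlavedSlotIn
import HarnessLib

/-!
# K2R `RealisedQuasiStaticCellLaw`, line `floquet-bloch`, stub `stub_lowSectorDecay` (S1D): the two gauged ladders of a
# principal coset on a FULL slot, coupling in trapezoid form

Summits-side helper file (everything proved; no definitions, no named facts; `--supports stmt-AnomalousDissipation-20446`).
The derivations buried in `outOfPlane_slot_contraction` / `inPlane_slot_contraction`, extracted as lemmas: on the full
slot `[a, a + τ_j]`, `a = pP + start j` (the dead right end of a period's last slot included), the gauged out-of-plane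
components `μ^{−J}⟪ζ, α(k_J)⟫` and in-plane components `μ^{−J}⟪p_J, α(k_J)⟫` of the coset `k_J = k₀ + J•K_j` solve the
real three-term ladders `v_J' = −Λ(d_J v_J + g(t)(s_{J−1}v_{J−1} − s_J v_{J+1}))` with `g(t) = g₁·trapezoid 0 τ_j ρ (t − a)`
(`gaugedOut_fullSlot`, `s ≡ 1`; `gaugedIn_fullSlot`, `s_J = p_J·p_{J+1}`).
-/

set_option linter.dupNamespace false

noncomputable section

namespace Summit.AnomalousDissipation.AnomalousDissipation.Theorems.SolenoidalFractalHomogenisation.RealisedQuasiStaticCellLaw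

open Set MeasureTheory Filter Topology Function Complex Matrix
open scoped InnerProductSpace ComplexConjugate Matrix
open Literature.Analysis Literature.Analysis.FunctionSpaces Literature.Analysis.FunctionSpaces.Torus
open Literature.Analysis.FluidPDE Literature.Analysis.FluidPDE.LatticeShear
open Literature.Analysis.ODE.ThreeTermLadder
open Summit.AnomalousDissipation.AnomalousDissipation.Theorems.SolenoidalFractalHomogenisation.PermissibleCarrier

variable {k₀ : ℕ}

/-- The replayed phase at the right end of a period vanishes. -/
theorem fract_mul_period_eq_zero_of_eq (W : LatticeWord k₀) (p : ℕ) {t : ℝ} (hteq : t = (p + 1 : ℝ) * W.period) :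
    Int.fract (t / W.period) * W.period = 0 := by
  have hP : 0 < W.period := period_pos W
  rw [hteq, mul_div_assoc, div_self hP.ne', mul_one, show ((p : ℝ) + 1) = ((p + 1 : ℕ) : ℝ) by push_cast; ring,
    Int.fract_natCast, zero_mul]

/-- The replayed phase inside the `p`-th period. -/
theorem fract_mul_period_eq_of_lt (W : LatticeWord k₀) (p : ℕ) (j : Fin k₀) {t : ℝ}
    (ht : t ∈ Icc ((p : ℝ) * W.period + W.start j) ((p : ℝ) * W.period + W.start j + (W.phase j).τ))
    (htP : t < (p + 1 : ℝ) * W.period) : Int.fract (t / W.period) * W.period = t - p * W.period := by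
  have hP : 0 < W.period := period_pos W
  have e : t = (p : ℤ) * W.period + (t - p * W.period) := by push_cast; ring
  rw [e, fract_period_mul hP (p : ℤ) (by linarith [ht.1, start_nonneg W j]) (by linarith)]
  push_cast; ring

/-- The slot coupling at the right end of a period's last slot vanishes in the trapezoid form too. -/
theorem trapezoid_fullSlot_end (W : LatticeWord k₀) (p : ℕ) (j : Fin k₀) {t : ℝ}
    (ht : t ∈ Icc ((p : ℝ) * W.period + W.start j) ((p : ℝ) * W.period + W.start j + (W.phase j).τ))
    (hteq : t = (p + 1 : ℝ) * W.period) :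
    LatticeWord.trapezoid 0 (W.phase j).τ W.ramp (t - ((p : ℝ) * W.period + W.start j)) = 0 := by
  have haτP : (p : ℝ) * W.period + W.start j + (W.phase j).τ ≤ (p + 1 : ℝ) * W.period := by
    have := start_add_tau_le_period W j; linarith
  have hta : t - ((p : ℝ) * W.period + W.start j) = (W.phase j).τ := by
    have : (p : ℝ) * W.period + W.start j + (W.phase j).τ = (p + 1 : ℝ) * W.period := le_antisymm haτP (hteq ▸ ht.2)
    linarith
  rw [hta, trapezoid_eq_of_mem_ramp_down (W.phase j).τ_pos W.ramp_pos W.ramp_le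
    ⟨by nlinarith [W.ramp_le, W.ramp_pos, (W.phase j).τ_pos], le_rfl⟩]
  simp

/-- **Gauged out-of-plane ladder on a full slot.** For `t ∈ [a, a + τ_j]`, `a = pP + start j`, `ζ ⊥ k₀, K_j` and a
resolved mode `k_J`, the gauged component `v_J = μ^{−J}⟪ζ, α_N(k_J)⟫` (`μ = i a_j/|a_j|`) satisfies
`v_J' = −Λ d_J v_J − g(t)Λ(v_{J−1} − v_{J+1})` within the slot, `g(t) = g₁·trapezoid 0 τ_j ρ (t − a)`. -/
theorem gaugedOut_fullSlot (W : LatticeWord k₀) {n : ℕ} (hn : 0 < n) {κ : ℝ} (hκ : 0 < κ)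
    (ℓ : Fin 3 → ℤ) {w₀ : UnitAddTorus (Fin 3) → EuclideanSpace ℝ (Fin 3)}
    (hw₀ : FunctionSpaces.Torus.MemSobolev 1 (FunctionSpaces.EuclideanSpace.complexify ∘ w₀))
    (hdiv : FunctionSpaces.Torus.IsWeaklyDivFree w₀) (hmean : FunctionSpaces.Torus.HasZeroMean w₀)
    (hsupp : ∀ k : Fin 3 → ℤ, ¬ ((∃ z : Fin 3 → ℤ, k = ℓ + (n:ℤ) • z) ∨ (∃ z : Fin 3 → ℤ, k = -ℓ + (n:ℤ) • z)) →
      UnitAddTorus.mFourierCoeff (FunctionSpaces.EuclideanSpace.complexify ∘ w₀) k = 0)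
    {N : ℕ} (hBN : (Finset.univ.biUnion fun j : Fin k₀ =>
        ({(fun i => (W.phase j).m i * n), -(fun i => (W.phase j).m i * n)} : Finset (Fin 3 → ℤ))) ⊆ freqBall N)
    {T : ℝ} (p : ℕ) (j : Fin k₀) (hT : (p : ℝ) * W.period + W.start j + (W.phase j).τ ≤ T)
    (k0 : Fin 3 → ℤ) {ζ : EuclideanSpace ℂ (Fin 3)} (hζ₀ : ∑ i, (k0 i : ℂ) * ζ i = 0)
    (hζK : ∑ i, (((fun i => (W.phase j).m i * (n : ℤ)) i : ℤ) : ℂ) * ζ i = 0)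
    (Λ g₁ : ℝ) (hΛ : Λ = κ * (4 * Real.pi ^ 2 * freqNormSq (fun i => (W.phase j).m i * (n : ℤ))))
    (hg₁ : g₁ = 2 * Real.pi * (∑ i, (W.phase j).e i * (k0 i : ℝ)) *
        ‖Complex.exp ((W.phase j).φ * Complex.I) *
          (1 / (2 * ((2 * Real.pi * ‖latticeVec (W.phase j).m‖ : ℝ) : ℂ) * Complex.I))‖ * (1 / (n : ℝ)) / Λ)
    (J : ℤ) (hJ : k0 + J • (fun i => (W.phase j).m i * (n : ℤ)) ∈ freqBall N) {t : ℝ}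
    (ht : t ∈ Icc ((p : ℝ) * W.period + W.start j) ((p : ℝ) * W.period + W.start j + (W.phase j).τ)) :
    HasDerivWithinAt
      (fun t' => (Complex.I * (Complex.exp ((W.phase j).φ * Complex.I) *
          (1 / (2 * ((2 * Real.pi * ‖latticeVec (W.phase j).m‖ : ℝ) : ℂ) * Complex.I))) /
          (‖Complex.exp ((W.phase j).φ * Complex.I) *
            (1 / (2 * ((2 * Real.pi * ‖latticeVec (W.phase j).m‖ : ℝ) : ℂ) * Complex.I))‖ : ℂ)) ^ (-J) *
        inner ℂ ζ ((pvSetup_cell W hn hκ.le ℓ hw₀ hdiv hmean hsupp).galerkinCoeffAt N t'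
          (k0 + J • (fun i => (W.phase j).m i * (n : ℤ)))))
      (-(Λ : ℂ) * ((((freqNormSq (k0 + J • (fun i => (W.phase j).m i * (n : ℤ))) /
            freqNormSq (fun i => (W.phase j).m i * (n : ℤ)) : ℝ) : ℂ)) *
          ((Complex.I * (Complex.exp ((W.phase j).φ * Complex.I) *
              (1 / (2 * ((2 * Real.pi * ‖latticeVec (W.phase j).m‖ : ℝ) : ℂ) * Complex.I))) /
              (‖Complex.exp ((W.phase j).φ * Complex.I) *
                (1 / (2 * ((2 * Real.pi * ‖latticeVec (W.phase j).m‖ : ℝ) : ℂ) * Complex.I))‖ : ℂ)) ^ (-J) *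
            inner ℂ ζ ((pvSetup_cell W hn hκ.le ℓ hw₀ hdiv hmean hsupp).galerkinCoeffAt N t
              (k0 + J • (fun i => (W.phase j).m i * (n : ℤ)))))) -
        ((g₁ * LatticeWord.trapezoid 0 (W.phase j).τ W.ramp (t - ((p : ℝ) * W.period + W.start j)) : ℝ) : ℂ) *
          (Λ : ℂ) *
          ((Complex.I * (Complex.exp ((W.phase j).φ * Complex.I) *
              (1 / (2 * ((2 * Real.pi * ‖latticeVec (W.phase j).m‖ : ℝ) : ℂ) * Complex.I))) /
              (‖Complex.exp ((W.phase j).φ * Complex.I) *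
                (1 / (2 * ((2 * Real.pi * ‖latticeVec (W.phase j).m‖ : ℝ) : ℂ) * Complex.I))‖ : ℂ)) ^ (-(J - 1)) *
              inner ℂ ζ ((pvSetup_cell W hn hκ.le ℓ hw₀ hdiv hmean hsupp).galerkinCoeffAt N t
                (k0 + (J - 1) • (fun i => (W.phase j).m i * (n : ℤ)))) -
            (Complex.I * (Complex.exp ((W.phase j).φ * Complex.I) *
              (1 / (2 * ((2 * Real.pi * ‖latticeVec (W.phase j).m‖ : ℝ) : ℂ) * Complex.I))) /
              (‖Complex.exp ((W.phase j).φ * Complex.I) *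
                (1 / (2 * ((2 * Real.pi * ‖latticeVec (W.phase j).m‖ : ℝ) : ℂ) * Complex.I))‖ : ℂ)) ^ (-(J + 1)) *
              inner ℂ ζ ((pvSetup_cell W hn hκ.le ℓ hw₀ hdiv hmean hsupp).galerkinCoeffAt N t
                (k0 + (J + 1) • (fun i => (W.phase j).m i * (n : ℤ))))))
      (Icc ((p : ℝ) * W.period + W.start j) ((p : ℝ) * W.period + W.start j + (W.phase j).τ)) t := by
  classical
  have hP : 0 < W.period := period_pos W
  have ha0 : 0 ≤ (p : ℝ) * W.period + W.start j := by
    have := start_nonneg W j; positivity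
  have haτP : (p : ℝ) * W.period + W.start j + (W.phase j).τ ≤ (p + 1 : ℝ) * W.period := by
    have := start_add_tau_le_period W j; linarith
  have hKpos : 0 < freqNormSq (fun i => (W.phase j).m i * (n : ℤ)) := by
    have hK0 : (fun i => (W.phase j).m i * (n : ℤ)) ≠ 0 := cellFreq_ne_zero (W.phase j) hn
    obtain ⟨i, hi⟩ : ∃ i, (fun i => (W.phase j).m i * (n : ℤ)) i ≠ 0 := by
      by_contra h
      push Not at h
      exact hK0 (funext h)
    have hi' : (((fun i => (W.phase j).m i * (n : ℤ)) i : ℤ) : ℝ) ≠ 0 := by exact_mod_cast hi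
    unfold freqNormSq
    exact lt_of_lt_of_le (by positivity) (Finset.single_le_sum (fun l _ =>
      sq_nonneg ((((fun i => (W.phase j).m i * (n : ℤ)) l : ℤ) : ℝ))) (Finset.mem_univ i))
  have htT : t ∈ Icc 0 T := ⟨ha0.trans ht.1, ht.2.trans hT⟩
  have hsub : Icc ((p : ℝ) * W.period + W.start j) ((p : ℝ) * W.period + W.start j + (W.phase j).τ) ⊆ Icc 0 T :=
    Icc_subset_Icc ha0 hT
  by_cases htP : t < (p + 1 : ℝ) * W.period
  · have hph := fract_mul_period_eq_of_lt W p j ht htP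
    have hrt : Int.fract (t / W.period) * W.period ∈ Icc (W.start j) (W.start j + (W.phase j).τ) := by
      rw [hph]; constructor <;> linarith [ht.1, ht.2]
    have h := hasDerivWithinAt_gauged_outOfPlane W hn hκ ℓ hw₀ hdiv hmean hsupp hBN htT j hrt k0 hζ₀ hζK J hJ
    refine (h.mono hsub).congr_deriv ?_
    rw [hph, trapezoid_shift, hg₁, hΛ]
    have e : t - p * W.period - W.start j = t - (p * W.period + W.start j) := by ring
    rw [e]
    have hKc : ((freqNormSq (fun i => (W.phase j).m i * (n : ℤ)) : ℝ) : ℂ) ≠ 0 := by exact_mod_cast hKpos.ne'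
    have hκc : ((κ : ℝ) : ℂ) ≠ 0 := by exact_mod_cast hκ.ne'
    have hπc : ((Real.pi : ℝ) : ℂ) ≠ 0 := by exact_mod_cast Real.pi_pos.ne'
    push_cast
    field_simp
    ring
  · have hteq : t = (p + 1 : ℝ) * W.period := le_antisymm (ht.2.trans haτP) (not_lt.1 htP)
    have hfr := fract_mul_period_eq_zero_of_eq W p hteq
    have h := hasDerivWithinAt_inner_galerkinCoeffAt_dead W hn hκ.le ℓ hw₀ hdiv hmean hsupp hBN htT hfr
      (k0 + J • (fun i => (W.phase j).m i * (n : ℤ))) hJ ζ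
    have h2 := (h.const_mul ((Complex.I * (Complex.exp ((W.phase j).φ * Complex.I) *
          (1 / (2 * ((2 * Real.pi * ‖latticeVec (W.phase j).m‖ : ℝ) : ℂ) * Complex.I))) /
          (‖Complex.exp ((W.phase j).φ * Complex.I) *
            (1 / (2 * ((2 * Real.pi * ‖latticeVec (W.phase j).m‖ : ℝ) : ℂ) * Complex.I))‖ : ℂ)) ^ (-J))).mono hsub
    refine h2.congr_deriv ?_
    rw [trapezoid_fullSlot_end W p j ht hteq, mul_zero, hΛ]
    have hKc : ((freqNormSq (fun i => (W.phase j).m i * (n : ℤ)) : ℝ) : ℂ) ≠ 0 := by exact_mod_cast hKpos.ne'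
    push_cast
    field_simp
    ring

/-- **Gauged in-plane ladder on a full slot.** Same slot and coset with all resolved `k_J ≠ 0`, `ζr` a real unit vector
`⊥ k₀, K_j`, Leray directions `p_J = k̂_J × ζr`: the gauged component `v_J = μ^{−J}⟪p_J, α_N(k_J)⟫` satisfies
`v_J' = −Λ d_J v_J − g(t)Λ((p_{J−1}·p_J) v_{J−1} − (p_J·p_{J+1}) v_{J+1})` within the slot. -/
theorem gaugedIn_fullSlot (W : LatticeWord k₀) {n : ℕ} (hn : 0 < n) {κ : ℝ} (hκ : 0 < κ)
    (ℓ : Fin 3 → ℤ) {w₀ : UnitAddTorus (Fin 3) → EuclideanSpace ℝ (Fin 3)}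
    (hw₀ : FunctionSpaces.Torus.MemSobolev 1 (FunctionSpaces.EuclideanSpace.complexify ∘ w₀))
    (hdiv : FunctionSpaces.Torus.IsWeaklyDivFree w₀) (hmean : FunctionSpaces.Torus.HasZeroMean w₀)
    (hsupp : ∀ k : Fin 3 → ℤ, ¬ ((∃ z : Fin 3 → ℤ, k = ℓ + (n:ℤ) • z) ∨ (∃ z : Fin 3 → ℤ, k = -ℓ + (n:ℤ) • z)) →
      UnitAddTorus.mFourierCoeff (FunctionSpaces.EuclideanSpace.complexify ∘ w₀) k = 0)
    {N : ℕ} (hBN : (Finset.univ.biUnion fun j : Fin k₀ =>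
        ({(fun i => (W.phase j).m i * n), -(fun i => (W.phase j).m i * n)} : Finset (Fin 3 → ℤ))) ⊆ freqBall N)
    {T : ℝ} (p : ℕ) (j : Fin k₀) (hT : (p : ℝ) * W.period + W.start j + (W.phase j).τ ≤ T)
    (k0 : Fin 3 → ℤ) (hk : ∀ J : ℤ, k0 + J • (fun i => (W.phase j).m i * (n : ℤ)) ∈ freqBall N →
      k0 + J • (fun i => (W.phase j).m i * (n : ℤ)) ≠ 0)
    {ζr : Fin 3 → ℝ} (hζ1 : ζr ⬝ᵥ ζr = 1) (hζ0 : ζr ⬝ᵥ (fun i => ((k0 i : ℤ) : ℝ)) = 0)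
    (hζKr : ζr ⬝ᵥ (fun i => (((fun i => (W.phase j).m i * (n : ℤ)) i : ℤ) : ℝ)) = 0)
    {pf : ℤ → Fin 3 → ℝ}
    (hp : ∀ J : ℤ, pf J = (Real.sqrt ((fun i => (((k0 + J • (fun i => (W.phase j).m i * (n : ℤ))) i : ℤ) : ℝ)) ⬝ᵥ
        (fun i => (((k0 + J • (fun i => (W.phase j).m i * (n : ℤ))) i : ℤ) : ℝ))))⁻¹ •
        (fun i => (((k0 + J • (fun i => (W.phase j).m i * (n : ℤ))) i : ℤ) : ℝ)) ⨯₃ ζr)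
    (Λ g₁ : ℝ) (hΛ : Λ = κ * (4 * Real.pi ^ 2 * freqNormSq (fun i => (W.phase j).m i * (n : ℤ))))
    (hg₁ : g₁ = 2 * Real.pi * (∑ i, (W.phase j).e i * (k0 i : ℝ)) *
        ‖Complex.exp ((W.phase j).φ * Complex.I) *
          (1 / (2 * ((2 * Real.pi * ‖latticeVec (W.phase j).m‖ : ℝ) : ℂ) * Complex.I))‖ * (1 / (n : ℝ)) / Λ)
    (J : ℤ) (hJ : k0 + J • (fun i => (W.phase j).m i * (n : ℤ)) ∈ freqBall N) {t : ℝ}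
    (ht : t ∈ Icc ((p : ℝ) * W.period + W.start j) ((p : ℝ) * W.period + W.start j + (W.phase j).τ)) :
    HasDerivWithinAt
      (fun t' => (Complex.I * (Complex.exp ((W.phase j).φ * Complex.I) *
          (1 / (2 * ((2 * Real.pi * ‖latticeVec (W.phase j).m‖ : ℝ) : ℂ) * Complex.I))) /
          (‖Complex.exp ((W.phase j).φ * Complex.I) *
            (1 / (2 * ((2 * Real.pi * ‖latticeVec (W.phase j).m‖ : ℝ) : ℂ) * Complex.I))‖ : ℂ)) ^ (-J) *
        inner ℂ (WithLp.toLp 2 (Complex.ofReal ∘ pf J) : EuclideanSpace ℂ (Fin 3))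
          ((pvSetup_cell W hn hκ.le ℓ hw₀ hdiv hmean hsupp).galerkinCoeffAt N t'
            (k0 + J • (fun i => (W.phase j).m i * (n : ℤ)))))
      (-(Λ : ℂ) * ((((freqNormSq (k0 + J • (fun i => (W.phase j).m i * (n : ℤ))) /
            freqNormSq (fun i => (W.phase j).m i * (n : ℤ)) : ℝ) : ℂ)) *
          ((Complex.I * (Complex.exp ((W.phase j).φ * Complex.I) *
              (1 / (2 * ((2 * Real.pi * ‖latticeVec (W.phase j).m‖ : ℝ) : ℂ) * Complex.I))) /
              (‖Complex.exp ((W.phase j).φ * Complex.I) *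
                (1 / (2 * ((2 * Real.pi * ‖latticeVec (W.phase j).m‖ : ℝ) : ℂ) * Complex.I))‖ : ℂ)) ^ (-J) *
            inner ℂ (WithLp.toLp 2 (Complex.ofReal ∘ pf J) : EuclideanSpace ℂ (Fin 3))
              ((pvSetup_cell W hn hκ.le ℓ hw₀ hdiv hmean hsupp).galerkinCoeffAt N t
                (k0 + J • (fun i => (W.phase j).m i * (n : ℤ)))))) -
        ((g₁ * LatticeWord.trapezoid 0 (W.phase j).τ W.ramp (t - ((p : ℝ) * W.period + W.start j)) : ℝ) : ℂ) *
          (Λ : ℂ) *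
          (((pf (J - 1) ⬝ᵥ pf J : ℝ) : ℂ) *
              ((Complex.I * (Complex.exp ((W.phase j).φ * Complex.I) *
                (1 / (2 * ((2 * Real.pi * ‖latticeVec (W.phase j).m‖ : ℝ) : ℂ) * Complex.I))) /
                (‖Complex.exp ((W.phase j).φ * Complex.I) *
                  (1 / (2 * ((2 * Real.pi * ‖latticeVec (W.phase j).m‖ : ℝ) : ℂ) * Complex.I))‖ : ℂ)) ^ (-(J - 1)) *
                inner ℂ (WithLp.toLp 2 (Complex.ofReal ∘ pf (J - 1)) : EuclideanSpace ℂ (Fin 3))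
                  ((pvSetup_cell W hn hκ.le ℓ hw₀ hdiv hmean hsupp).galerkinCoeffAt N t
                    (k0 + (J - 1) • (fun i => (W.phase j).m i * (n : ℤ))))) -
            ((pf J ⬝ᵥ pf (J + 1) : ℝ) : ℂ) *
              ((Complex.I * (Complex.exp ((W.phase j).φ * Complex.I) *
                (1 / (2 * ((2 * Real.pi * ‖latticeVec (W.phase j).m‖ : ℝ) : ℂ) * Complex.I))) /
                (‖Complex.exp ((W.phase j).φ * Complex.I) *
                  (1 / (2 * ((2 * Real.pi * ‖latticeVec (W.phase j).m‖ : ℝ) : ℂ) * Complex.I))‖ : ℂ)) ^ (-(J + 1)) *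
                inner ℂ (WithLp.toLp 2 (Complex.ofReal ∘ pf (J + 1)) : EuclideanSpace ℂ (Fin 3))
                  ((pvSetup_cell W hn hκ.le ℓ hw₀ hdiv hmean hsupp).galerkinCoeffAt N t
                    (k0 + (J + 1) • (fun i => (W.phase j).m i * (n : ℤ)))))))
      (Icc ((p : ℝ) * W.period + W.start j) ((p : ℝ) * W.period + W.start j + (W.phase j).τ)) t := by
  classical
  set hPV := pvSetup_cell W hn hκ.le ℓ hw₀ hdiv hmean hsupp with hPVdef
  set K : Fin 3 → ℤ := fun i => (W.phase j).m i * (n : ℤ) with hK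
  set A : ℂ := Complex.exp ((W.phase j).φ * Complex.I) *
      (1 / (2 * ((2 * Real.pi * ‖latticeVec (W.phase j).m‖ : ℝ) : ℂ) * Complex.I)) with hA
  have hA0 : A ≠ 0 := layerAmp_ne_zero (W.phase j)
  set pc : ℤ → EuclideanSpace ℂ (Fin 3) := fun J => WithLp.toLp 2 (Complex.ofReal ∘ pf J) with hpc
  set u : ℝ → ℤ → ℂ := fun t J => inner ℂ (pc J) (hPV.galerkinCoeffAt N t (k0 + J • K)) with hu
  have hP : 0 < W.period := period_pos W
  have ha0 : 0 ≤ (p : ℝ) * W.period + W.start j := by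
    have := start_nonneg W j; positivity
  have haτP : (p : ℝ) * W.period + W.start j + (W.phase j).τ ≤ (p + 1 : ℝ) * W.period := by
    have := start_add_tau_le_period W j; linarith
  have hK0 : K ≠ 0 := cellFreq_ne_zero (W.phase j) hn
  have hKpos : 0 < freqNormSq K := by
    obtain ⟨i, hi⟩ : ∃ i, K i ≠ 0 := by
      by_contra h
      push Not at h
      exact hK0 (funext h)
    have hi' : (K i : ℝ) ≠ 0 := by exact_mod_cast hi
    unfold freqNormSq
    exact lt_of_lt_of_le (by positivity) (Finset.single_le_sum (fun l _ => sq_nonneg ((K l : ℝ))) (Finset.mem_univ i))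
  have htT : t ∈ Icc 0 T := ⟨ha0.trans ht.1, ht.2.trans hT⟩
  have hsub : Icc ((p : ℝ) * W.period + W.start j) ((p : ℝ) * W.period + W.start j + (W.phase j).τ) ⊆ Icc 0 T :=
    Icc_subset_Icc ha0 hT
  -- the coupling scalar is real
  have hθ : ∑ i, (EuclideanSpace.complexify (W.phase j).e) i * (k0 i : ℂ) =
      ((∑ i, (W.phase j).e i * (k0 i : ℝ) : ℝ) : ℂ) := by
    push_cast
    refine Finset.sum_congr rfl fun i _ => ?_
    rw [EuclideanSpace.complexify_apply]
  -- the statement is about `u`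
  change HasDerivWithinAt (fun t' => (Complex.I * A / (‖A‖ : ℂ)) ^ (-J) * u t' J)
    (-(Λ : ℂ) * ((((freqNormSq (k0 + J • K) / freqNormSq K : ℝ) : ℂ)) * ((Complex.I * A / (‖A‖ : ℂ)) ^ (-J) * u t J)) -
      ((g₁ * LatticeWord.trapezoid 0 (W.phase j).τ W.ramp (t - ((p : ℝ) * W.period + W.start j)) : ℝ) : ℂ) *
        (Λ : ℂ) * (((pf (J - 1) ⬝ᵥ pf J : ℝ) : ℂ) * ((Complex.I * A / (‖A‖ : ℂ)) ^ (-(J - 1)) * u t (J - 1)) -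
          ((pf J ⬝ᵥ pf (J + 1) : ℝ) : ℂ) * ((Complex.I * A / (‖A‖ : ℂ)) ^ (-(J + 1)) * u t (J + 1))))
    (Icc ((p : ℝ) * W.period + W.start j) ((p : ℝ) * W.period + W.start j + (W.phase j).τ)) t
  by_cases htP : t < (p + 1 : ℝ) * W.period
  · have hph := fract_mul_period_eq_of_lt W p j ht htP
    have hrt : Int.fract (t / W.period) * W.period ∈ Icc (W.start j) (W.start j + (W.phase j).τ) := by
      rw [hph]; constructor <;> linarith [ht.1, ht.2]
    have h1' := hasDerivWithinAt_inPlane_slot W hn hκ.le ℓ hw₀ hdiv hmean hsupp hBN htT j hrt k0 hk hζ1 hζ0 hζKr hp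
      J hJ
    set c : ℝ := (1 / (n : ℝ)) * LatticeWord.trapezoid (W.start j) (W.phase j).τ W.ramp
      (Int.fract (t / W.period) * W.period) with hc
    set r : ℂ := ((2 * Real.pi * (∑ i, (W.phase j).e i * (k0 i : ℝ)) * c : ℝ) : ℂ) with hr
    have h2 : HasDerivWithinAt (fun t' => u t' J)
        (-(((κ * (4 * Real.pi ^ 2 * freqNormSq (k0 + J • K))) : ℝ) : ℂ) * u t J -
          (r * Complex.I) * (A * (((pf J ⬝ᵥ pf (J - 1) : ℝ) : ℂ) * u t (J - 1)) +
            conj A * (((pf J ⬝ᵥ pf (J + 1) : ℝ) : ℂ) * u t (J + 1)))) (Icc 0 T) t := by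
      refine h1'.congr_deriv ?_
      rw [hθ, layerAmp_conj (W.phase j)]
      simp only [hu, hpc, hA, hr, hK]
      push_cast
      ring
    have h3 := (h2.const_mul ((Complex.I * A / (‖A‖ : ℂ)) ^ (-J))).mono hsub
    refine h3.congr_deriv ?_
    rw [gauge_rhs hA0]
    have hKc : ((freqNormSq K : ℝ) : ℂ) ≠ 0 := by exact_mod_cast hKpos.ne'
    have hκc : ((κ : ℝ) : ℂ) ≠ 0 := by exact_mod_cast hκ.ne'
    have hπc : ((Real.pi : ℝ) : ℂ) ≠ 0 := by exact_mod_cast Real.pi_pos.ne'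
    have hs1 : pf (J - 1) ⬝ᵥ pf J = pf J ⬝ᵥ pf (J - 1) := dotProduct_comm _ _
    rw [hs1]
    have hc' : c = (1 / (n : ℝ)) * LatticeWord.trapezoid 0 (W.phase j).τ W.ramp (t - ((p : ℝ) * W.period + W.start j)) := by
      rw [hc, hph, trapezoid_shift]
      have e : t - p * W.period - W.start j = t - (p * W.period + W.start j) := by ring
      rw [e]
    simp only [hr, hc', hg₁, hΛ]
    generalize (Complex.I * A / (‖A‖ : ℂ)) ^ (-J) = μ₁
    generalize (Complex.I * A / (‖A‖ : ℂ)) ^ (-(J - 1)) = μ₂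
    generalize (Complex.I * A / (‖A‖ : ℂ)) ^ (-(J + 1)) = μ₃
    generalize (‖A‖ : ℝ) = nA
    push_cast
    field_simp
  · have hteq : t = (p + 1 : ℝ) * W.period := le_antisymm (ht.2.trans haτP) (not_lt.1 htP)
    have hfr := fract_mul_period_eq_zero_of_eq W p hteq
    have h := hasDerivWithinAt_inner_galerkinCoeffAt_dead W hn hκ.le ℓ hw₀ hdiv hmean hsupp hBN htT hfr (k0 + J • K)
      hJ (pc J)
    have h2 := (h.const_mul ((Complex.I * A / (‖A‖ : ℂ)) ^ (-J))).mono hsub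
    refine h2.congr_deriv ?_
    rw [trapezoid_fullSlot_end W p j ht hteq, mul_zero, hΛ]
    simp only [hu]
    have hKc : ((freqNormSq K : ℝ) : ℂ) ≠ 0 := by exact_mod_cast hKpos.ne'
    push_cast
    field_simp
    ring

end Summit.AnomalousDissipation.AnomalousDissipation.Theorems.SolenoidalFractalHomogenisation.RealisedQuasiStaticCellLaw

end
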